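import Literature.Barriers.HubbardSuperconductivity.HohenbergMerminWagnerPairing
import Literature.MathematicalPhysics.QuantumLattice.DuhamelEqualTimeBounds
import HarnessLib

/-!
# Barrier `HohenbergMerminWagnerPairing`, susceptibility (Duhamel) form: no DUHAMEL pair-field order at `T > 0` in two
dimensions — the static pair-field susceptibility is `o(L²)` at every fixed `β`, uniformly in `U`, `μ`

Companion of `HohenbergMerminWagnerPairing.lean` (barrier catalogue `Literature/Barriers/HubbardSuperconductivity/`,
D-0021) and of `HohenbergMerminWagnerPairingQuasiAverage.lean`. Those entries PROVE, for the nearest-neighbour Hubbard model on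
the tori `(ℤ/Lℤ)²` at any `0 ≤ β < ∞`, that neither carrier of pair ORDER survives: the equal-time two-point function
`⟨P_x† P_y⟩_{β,L}` decays like `C_g (dist(x,y)+1)^{-f(β|t|)}` (Koma–Tasaki 1992), so there is no pair-field long-range order,
and the sourced (quasi-average) order parameter vanishes as the source is removed (Su–Suzuki 1998). The present file treats the
THIRD carrier, the one in which a pairing «instability» is usually phrased: the static (zero-frequency, Kubo–Mori/DUHAMEL)
pair-field susceptibility `χ_L = β · Re (Δ_g†, Δ_g)_Duh / L²`, `(A, B) = Z⁻¹ ∫₀¹ tr(A e^{-sβH} B e^{-(1-s)βH}) ds`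
(`Matrix.duhamel`, Dyson–Lieb–Simon 1978 (5); Scalapino 1995 (2.4): `P_d = ∫₀^β ⟨Δ_d(τ)† Δ_d(0)⟩ dτ/|Λ|`). It PROVES:

* `norm_thermalCorr_bondPair_rev_le_exp`, `norm_thermalCorr_bondPair_rev_torus_le`, `norm_thermalCorr_localPair_rev_le` — the
  Koma–Tasaki/McBryan–Spencer gauge bound for the pair correlation in the REVERSED operator order (pair-CREATION-field
  correlations), `‖⟨P_x (P_y)†⟩_{β,L}‖ ≤ C_g (dist(x,y)+1)^{-f(β|t|)}` with the SAME constant `C_g = pairFieldDecayConst g` and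
  exponent `f = pairDecayExponent (β|t|)` as the sibling's `norm_thermalCorr_localPair_le`, uniformly in `L`, `U`, `μ`: the
  observable `b_{wz} (b_{uv})†` is a gauge eigenvector with the inverse factor `e^{(φ_w+φ_z)-(φ_u+φ_v)}`, so the sibling's
  radial potential centred at the ANNIHILATION site does the job (Koma–Tasaki's footnote [10] covers every monomial
  `P_x = c ⋯ c`; the reversed order is the case needed for anticommutator / symmetrised correlations).
* `gibbsState_conjTranspose_pairField_mul`, `gibbsState_pairField_mul_conjTranspose` (bilinear expansions of `⟨Δ_g†Δ_g⟩`,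
  `⟨Δ_gΔ_g†⟩` in local pairs) and `re_gibbsState_conjTranspose_pairField_mul_le`, `re_gibbsState_pairField_mul_conjTranspose_le`:
  both are `≤ C_g Σ_{x,y} (dist(x,y)+1)^{-f}`.
* `re_duhamel_pairField_le` — **the Duhamel bound**: `Re (Δ_g†, Δ_g)_Duh ≤ C_g Σ_{x,y∈(ℤ/Lℤ)²} (dist(x,y)+1)^{-f(β|t|)}`, from the
  tree's `re_duhamel_conjTranspose_le` (`b ≤ g`, [DLS1978] Thm. 3.1 for a GENERAL observable: `Re (A, A†) ≤ ½(Re⟨AA†⟩ + Re⟨A†A⟩)`,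
  file `DuhamelEqualTimeBounds`) at `A = Δ_g†` and the two bounds above;
  `re_duhamel_pairField_le_of_radius` — hence `≤ C_g L² ((2R+1)² + L² (R+1)^{-f})` for every cut-off radius `R`
  (the sibling programme's `sum_rpow_torusDist_le`);
  `re_duhamel_pairField_div_small` — hence for every `β ≥ 0`, `t`, `g`, `ε > 0` there is `L₀` with
  `Re (Δ_g†, Δ_g)_Duh / L⁴ ≤ ε` for ALL `L ≥ L₀`, `U`, `μ`: NO `L`-uniform floor on the Duhamel-normalised pair order parameter
  at any positive temperature — equivalently the static pair-field susceptibility `χ_L = β Re(Δ_g†,Δ_g)/L²` is `o(L²)`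
  (`≤ β C_g (2R+1)² + β C_g L² (R+1)^{-f}`), the susceptibility twin of the sibling's `not_hasTorusLRO_thermalPairFieldCorr`.

Reading for the summit's bridge audit (LADDER-Hubbard wording (ii) «T > 0 instability vs every-ground-state LRO», cell
gate-hubbard-kl, row B0f of BRIDGE-AUDIT): the Kohn–Luttinger «instability» is a statement about the growth of `χ_L(β)` as
`β` approaches the onset scale; at every `L`-INDEPENDENT `β` — the habitat of the KL pair, `β ≤ e^{c/U²}` — the Duhamel
carrier of pair ORDER (`χ_L ≍ β L²`, i.e. an `L`-uniform floor on `Re(Δ†,Δ)/L⁴`) is as dead as the equal-time and the sourced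
ones; what is NOT excluded is an `L`-divergent `χ_L = O(L^{2-f})` (Kosterlitz–Thouless-type quasi-order, `f → 0` as
`β → ∞`), which no tree arrow connects to the `T = 0` every-ground-state matrix. Nothing is asserted at `T = 0`.

Sources: T. Koma, H. Tasaki, Phys. Rev. Lett. 68 (1992) 3248, Theorem, eqs. (5)–(12), p. 3 and footnote [10]
(`KomaTasakiPRL1992`); F. J. Dyson, E. H. Lieb, B. Simon, J. Stat. Phys. 18 (1978) 335, eq. (5) and Thm. 3.1 (`DLS1978`);
D. J. Scalapino, Phys. Rep. 250 (1995) 329, §2 (2.4) (`Scalapino1995`); O. McBryan, T. Spencer, Comm. Math. Phys. 53 (1977) 299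
(`McBryanSpencer1977`). No definition and no named fact is introduced.

## Mathlib / tree search

REUSED: `bondPair`, `siteGauge_mul_bondPair_mul`, `siteGauge_mul_bondPair_conjTranspose_mul`, `norm_bondPair_le_two`,
`radialPotential` (+ `_center`, `_of_le`, `_ge_of`, `_le_of`, `_energy_le`), `pairDecayExponent` (+ `_pos`, `_eq`),
`localPair_eq_sum_bondPair`, `torusDist_add_proj_le_one`, `pairFieldDecayConst` (`HohenbergMerminWagnerPairing`);
`norm_gibbsState_le_of_gauge` (`HubbardHubbardModelPairDecayProofs`); `siteGauge_conj_mul`, `siteGauge_inv`, `isUnit_siteGauge`,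
`siteGauge_conj_hamiltonianWith_add_conjTranspose`, `norm_hoppingPerturbation_le`, `isHermitian_hamiltonianWith`
(`HubbardGaugeBound`); `re_duhamel_conjTranspose_le` (`DuhamelEqualTimeBounds`); `sum_rpow_torusDist_le`
(`HubbardHubbardModelProofs`); `pairField`, `localPair` (`PairCorrelations`); Mathlib `log_add_one_le_harmonic`,
`tendsto_rpow_neg_atTop`. `lean search 'localPair g L x\) \(localPair|pairField g L \* \(pairField|duhamel.*pairField'`: no
reversed-order pair bound and no Duhamel pair-field bound existed in the tree (2026-08-26).
-/

noncomputable section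

open Matrix Finset NormedSpace Literature.MathematicalPhysics.QuantumLattice Literature.Probability.LatticeModels
open scoped Matrix.Norms.L2Operator ComplexOrder

namespace Literature.Barriers.HubbardSuperconductivity

/-! ### The reversed pair observable `b_{wz} (b_{uv})†` on a finite graph: gauge covariance and a priori bound -/

section Graph

variable {Λ : Type*} [LinearOrder Λ] [Fintype Λ]

/-- **Koma–Tasaki eq. (8) for the reversed pair observable `A = b_{wz} (b_{uv})†`**: `A` is an eigenvector of the gauge
conjugation with the INVERSE eigenvalue `exp[(φ_w + φ_z) - (φ_u + φ_v)]` of the sibling's `(b_{uv})† b_{wz}`.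
[cite: KomaTasakiPRL1992, eq. (8) and footnote [10]] -/
theorem siteGauge_mul_bondPairRev_mul (φ : Λ → ℝ) (u v w z : Λ) :
    siteGauge φ * (bondPair w z * (bondPair u v)ᴴ) * siteGauge (-φ) =
      ((Real.exp ((φ w + φ z) + -(φ u + φ v)) : ℝ) : ℂ) • (bondPair w z * (bondPair u v)ᴴ) := by
  rw [siteGauge_conj_mul, siteGauge_mul_bondPair_mul, siteGauge_mul_bondPair_conjTranspose_mul,
    smul_mul_smul, ← Complex.ofReal_mul, ← Real.exp_add]

/-- `‖b_{wz} (b_{uv})†‖ ≤ 4`. [folklore] -/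
private theorem norm_bondPairRev_le_four (u v w z : Λ) :
    ‖(bondPair w z * (bondPair u v)ᴴ : Matrix (Finset (Orb Λ)) (Finset (Orb Λ)) ℂ)‖ ≤ 4 := by
  refine (norm_mul_le _ _).trans ?_
  rw [l2_opNorm_conjTranspose]
  nlinarith [norm_bondPair_le_two u v, norm_bondPair_le_two w z,
    norm_nonneg (bondPair u v : Matrix (Finset (Orb Λ)) (Finset (Orb Λ)) ℂ),
    norm_nonneg (bondPair w z : Matrix (Finset (Orb Λ)) (Finset (Orb Λ)) ℂ)]

variable (G : SimpleGraph Λ) [DecidableRel G.Adj]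

/-- **Koma–Tasaki's a priori bound for bond pairs, reversed operator order**: for the grand-canonical Hubbard model
`H(t, U) - μN` on an arbitrary finite graph, every real site function `φ`, `β ≥ 0` and sites `u, v, w, z`,
`|⟨b_{wz} (b_{uv})†⟩_β| ≤ 4 · exp[(φ_w + φ_z) - (φ_u + φ_v)] · exp[β |t| Σ_a Σ_b [a ∼ b] 2(cosh(φ_a - φ_b) - 1)]`
— the tree's `norm_gibbsState_le_of_gauge` fed with `siteGauge_mul_bondPairRev_mul`; the hopping cost is that of the sibling's
`norm_thermalCorr_bondPair_le_exp` verbatim. [cite: KomaTasakiPRL1992, eqs. (6)–(12) and footnote [10]] -/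
theorem norm_thermalCorr_bondPair_rev_le_exp (t U μ : ℝ) {β : ℝ} (hβ : 0 ≤ β) (φ : Λ → ℝ)
    (u v w z : Λ) :
    ‖(hamiltonianWith G t U μ).thermalCorr β (bondPair w z) (bondPair u v)ᴴ‖ ≤
      4 * Real.exp ((φ w + φ z) + -(φ u + φ v)) *
        Real.exp (β * (|t| * ∑ a : Λ, ∑ b : Λ,
          if G.Adj a b then 2 * (Real.cosh (φ a - φ b) - 1) else 0)) := by
  set H : Matrix (Finset (Orb Λ)) (Finset (Orb Λ)) ℂ := hamiltonianWith G t U μ with hH_def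
  set A : Matrix (Finset (Orb Λ)) (Finset (Orb Λ)) ℂ := bondPair w z * (bondPair u v)ᴴ
    with hA_def
  set V : Matrix (Finset (Orb Λ)) (Finset (Orb Λ)) ℂ :=
    -(t : ℂ) • hoppingForm G (fun a b => Real.cosh (φ a - φ b) - 1) with hV_def
  set c : ℝ := |t| * ∑ a : Λ, ∑ b : Λ,
    if G.Adj a b then 2 * (Real.cosh (φ a - φ b) - 1) else 0 with hc_def
  set κ : ℝ := Real.exp ((φ w + φ z) + -(φ u + φ v)) with hκ_def
  have hH : H.IsHermitian := isHermitian_hamiltonianWith G t U μ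
  have hD : IsUnit (siteGauge φ) := isUnit_siteGauge φ
  have hA : siteGauge φ * A * (siteGauge φ)⁻¹ = ((κ : ℝ) : ℂ) • A := by
    rw [siteGauge_inv]
    exact siteGauge_mul_bondPairRev_mul φ u v w z
  have hV : siteGauge φ * H * (siteGauge φ)⁻¹ + (siteGauge φ * H * (siteGauge φ)⁻¹)ᴴ =
      (2 : ℂ) • (H + V) := by
    rw [siteGauge_inv]
    exact siteGauge_conj_hamiltonianWith_add_conjTranspose G φ t U μ
  have hc : ‖V‖ ≤ c := norm_hoppingPerturbation_le G φ t
  have h := norm_gibbsState_le_of_gauge hH hD hA hV hc hβ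
  have hκ : ‖((κ : ℝ) : ℂ)‖ = κ := by
    rw [Complex.norm_real, Real.norm_of_nonneg (Real.exp_pos _).le]
  have hthermal : H.thermalCorr β (bondPair w z) (bondPair u v)ᴴ = gibbsState β H A := rfl
  rw [hthermal]
  calc ‖gibbsState β H A‖
      ≤ ‖((κ : ℝ) : ℂ)‖ * ‖A‖ * Real.exp (β * c) := h
    _ ≤ ‖((κ : ℝ) : ℂ)‖ * 4 * Real.exp (β * c) := by
        gcongr
        exact norm_bondPairRev_le_four u v w z
    _ = 4 * κ * Real.exp (β * c) := by rw [hκ]; ring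

end Graph

/-! ### Power-law decay on the two-dimensional torus, reversed order -/

section Torus

variable {L : ℕ} [NeZero L]

/-- **Koma–Tasaki bound for bond pairs on `(ℤ/Lℤ)²`, reversed operator order**: for all `t, U, μ`, `β ≥ 0`, sites `x, y`
and partner sites `x', y'` within torus distance `1` of `x`, `y` respectively,
`|⟨b_{x x'} (b_{y y'})†⟩_{β, L}| ≤ 4 e² (dist(x, y) + 1)^{-f(β|t|)}` (`f = pairDecayExponent`), uniformly in `L`, `U`, `μ` —
the sibling's `norm_thermalCorr_bondPair_torus_le` with the radial potential now centred at the annihilation site `x`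
(`φ_x = 0`, `φ_{x'} ≤ q`, `φ_y = qH(R)`, `φ_{y'} ≥ qH(R) - q`, `R = dist(y, x)`), same charge `q = 1/(1 + 128β|t|)`, same energy
`≤ 128 q² H(R)`. [cite: KomaTasakiPRL1992, Theorem eq. (2), footnote [10], proof eqs. (5)–(12)] -/
theorem norm_thermalCorr_bondPair_rev_torus_le (t U μ : ℝ) {β : ℝ} (hβ : 0 ≤ β)
    (x x' y y' : TorusSite 2 L) (hx' : torusDist x' x ≤ 1) (hy' : torusDist y' y ≤ 1) :
    ‖(hubbardTorusWith 2 L t U μ).thermalCorr β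
        (bondPair (FermionTorus.ofTorusSite x) (FermionTorus.ofTorusSite x'))
        (bondPair (FermionTorus.ofTorusSite y) (FermionTorus.ofTorusSite y'))ᴴ‖ ≤
      4 * Real.exp 2 * ((torusDist x y : ℝ) + 1) ^ (-pairDecayExponent (β * |t|)) := by
  -- constants, as in the sibling
  set B : ℝ := 128 * (β * |t|) with hB
  have hB0 : 0 ≤ B := by positivity
  set q : ℝ := 1 / (1 + B) with hq
  have hq0 : 0 < q := by positivity
  have hq1 : q ≤ 1 := by
    rw [hq, div_le_one (by positivity)]
    linarith
  set f : ℝ := 2 * q - B * q ^ 2 with hf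
  have hfeq : pairDecayExponent (β * |t|) = f := by
    rw [pairDecayExponent_eq (by positivity : 0 ≤ β * |t|)]
  -- the radial potential centred at the ANNIHILATION site `x`, radius `R = dist(y, x)`
  set R : ℕ := torusDist y x with hR
  set φ : TorusSite 2 L → ℝ := radialPotential L x R q with hφ
  have key := norm_thermalCorr_bondPair_rev_le_exp (fermionTorusGraph 2 L) t U μ hβ
    (fun u => φ (FermionTorus.toTorusSite u)) (FermionTorus.ofTorusSite y)
    (FermionTorus.ofTorusSite y') (FermionTorus.ofTorusSite x) (FermionTorus.ofTorusSite x')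
  have hsumeq : (∑ u : FermionTorus 2 L, ∑ v : FermionTorus 2 L,
      if (fermionTorusGraph 2 L).Adj u v then
        2 * (Real.cosh (φ (FermionTorus.toTorusSite u) - φ (FermionTorus.toTorusSite v)) - 1)
      else 0) =
      ∑ a : TorusSite 2 L, ∑ b : TorusSite 2 L,
        if (torusGraph 2 L).Adj a b then 2 * (Real.cosh (φ a - φ b) - 1) else 0 := by
    refine Fintype.sum_equiv FermionTorus.equivTorusSite _ _ fun u => ?_
    refine Fintype.sum_equiv FermionTorus.equivTorusSite _ _ fun v => ?_
    simp [FermionTorus.equivTorusSite]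
  simp only [FermionTorus.toTorusSite_ofTorusSite] at key
  rw [hsumeq] at key
  refine Eq.trans_le ?_ (key.trans ?_)
  · congr!
  -- values of the potential at the four sites
  have hφx : φ x = 0 := radialPotential_center x R q
  have hφy : φ y = q * (harmonic R : ℝ) := radialPotential_of_le x q le_rfl
  have hφy' : q * (harmonic R : ℝ) - q ≤ φ y' := by
    refine radialPotential_ge_of x hq0.le ?_
    calc R = torusDist y x := hR
      _ ≤ torusDist y y' + torusDist y' x := torusDist_triangle' y y' x
      _ ≤ 1 + torusDist y' x := by rw [torusDist_comm' y y']; exact Nat.add_le_add_right hy' _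
      _ = torusDist y' x + 1 := Nat.add_comm _ _
  have hφx' : φ x' ≤ q := radialPotential_le_of x R hq0.le hx'
  have hexp : (φ x + φ x') + -(φ y + φ y') ≤ -2 * (q * (harmonic R : ℝ)) + 2 := by
    rw [hφx, hφy]
    linarith
  -- energy
  have hE := radialPotential_energy_le (L := L) x R hq0.le hq1
  have hβt : 0 ≤ β * |t| := by positivity
  have hE' : β * (|t| * ∑ a : TorusSite 2 L, ∑ b : TorusSite 2 L,
      (if (torusGraph 2 L).Adj a b then 2 * (Real.cosh (φ a - φ b) - 1) else 0)) ≤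
      B * q ^ 2 * (harmonic R : ℝ) := by
    calc β * (|t| * ∑ a : TorusSite 2 L, ∑ b : TorusSite 2 L,
          (if (torusGraph 2 L).Adj a b then 2 * (Real.cosh (φ a - φ b) - 1) else 0))
        = (β * |t|) * ∑ a : TorusSite 2 L, ∑ b : TorusSite 2 L,
          (if (torusGraph 2 L).Adj a b then 2 * (Real.cosh (φ a - φ b) - 1) else 0) := by
          ring
      _ ≤ (β * |t|) * (128 * q ^ 2 * (harmonic R : ℝ)) := mul_le_mul_of_nonneg_left hE hβt
      _ = B * q ^ 2 * (harmonic R : ℝ) := by rw [hB]; ring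
  -- arithmetic
  have hHR : Real.log ((R : ℝ) + 1) ≤ (harmonic R : ℝ) := by
    have := log_add_one_le_harmonic R
    push_cast at this
    exact this
  have hf0 : 0 < f := by rw [← hfeq]; exact pairDecayExponent_pos hβt
  have hRpos : (0 : ℝ) < (R : ℝ) + 1 := by positivity
  have hRxy : torusDist x y = R := by rw [hR, torusDist_comm' x y]
  calc 4 * Real.exp ((φ x + φ x') + -(φ y + φ y')) *
        Real.exp (β * (|t| * ∑ a : TorusSite 2 L, ∑ b : TorusSite 2 L,
          (if (torusGraph 2 L).Adj a b then 2 * (Real.cosh (φ a - φ b) - 1) else 0)))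
      ≤ 4 * Real.exp (-2 * (q * (harmonic R : ℝ)) + 2) *
          Real.exp (B * q ^ 2 * (harmonic R : ℝ)) := by
        gcongr
    _ = 4 * Real.exp 2 * Real.exp (-(f * (harmonic R : ℝ))) := by
        rw [mul_assoc 4 (Real.exp 2), ← Real.exp_add, mul_assoc 4, ← Real.exp_add, hf]
        congr 2
        ring
    _ ≤ 4 * Real.exp 2 * Real.exp (-(f * Real.log ((R : ℝ) + 1))) := by
        gcongr
    _ = 4 * Real.exp 2 * (((torusDist x y : ℕ) : ℝ) + 1) ^ (-pairDecayExponent (β * |t|)) := by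
        rw [hfeq, hRxy, Real.rpow_def_of_pos hRpos]
        congr 2
        ring

end Torus

/-! ### The pair field with an arbitrary form factor, reversed order -/

section PairField

variable (g : Site 2 → ℝ) (L : ℕ) [NeZero L]

/-- Bilinear expansion of the reversed thermal pair-field two-point function `⟨P_x (P_y)†⟩` in bond pairs. [folklore] -/
private theorem thermalCorr_localPair_rev_eq (β : ℝ)
    (H : Matrix (Finset (Orb (FermionTorus 2 L))) (Finset (Orb (FermionTorus 2 L))) ℂ)
    (x y : TorusSite 2 L) :
    H.thermalCorr β (localPair g L x) (localPair g L y)ᴴ =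
      ∑ e ∈ insert (0 : Site 2) unitSteps, ∑ e' ∈ insert (0 : Site 2) unitSteps,
        ((g e / Real.sqrt 2 : ℝ) : ℂ) * ((g e' / Real.sqrt 2 : ℝ) : ℂ) *
          H.thermalCorr β
            (bondPair (FermionTorus.ofTorusSite x) (FermionTorus.ofTorusSite (x + Torus.proj L e)))
            (bondPair (FermionTorus.ofTorusSite y)
              (FermionTorus.ofTorusSite (y + Torus.proj L e')))ᴴ := by
  rw [Matrix.thermalCorr, localPair_eq_sum_bondPair, localPair_eq_sum_bondPair, conjTranspose_sum,
    Finset.sum_mul, map_sum]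
  refine Finset.sum_congr rfl fun e _ => ?_
  rw [Finset.mul_sum, map_sum]
  refine Finset.sum_congr rfl fun e' _ => ?_
  rw [conjTranspose_smul, Matrix.smul_mul, Matrix.mul_smul, smul_smul, map_smul, smul_eq_mul,
    Matrix.thermalCorr]
  congr 1
  rw [Complex.star_def, Complex.conj_ofReal]

variable {L}

/-- **Power-law decay of the REVERSED thermal pair-field correlations in two dimensions**: for every form factor
`g : ℤ² → ℝ`, all `t`, `U`, `μ` and `β ≥ 0`, uniformly in the side `L`,
`|⟨P_x (P_y)†⟩_{β, L}| ≤ C_g (dist(x, y) + 1)^{-f(β|t|)}` with the sibling's constant `C_g = pairFieldDecayConst g` and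
exponent `f = pairDecayExponent` (`P_x = localPair g L x`). [cite: KomaTasakiPRL1992, Theorem eq. (2) and footnote [10]] -/
theorem norm_thermalCorr_localPair_rev_le (t U μ : ℝ) {β : ℝ} (hβ : 0 ≤ β) (x y : TorusSite 2 L) :
    ‖(hubbardTorusWith 2 L t U μ).thermalCorr β (localPair g L x) (localPair g L y)ᴴ‖ ≤
      pairFieldDecayConst g * ((torusDist x y : ℝ) + 1) ^ (-pairDecayExponent (β * |t|)) := by
  set D : ℝ := ((torusDist x y : ℝ) + 1) ^ (-pairDecayExponent (β * |t|)) with hD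
  have hD0 : 0 ≤ D := Real.rpow_nonneg (by positivity) _
  set S : Finset (Site 2) := insert (0 : Site 2) unitSteps with hS
  set a : Site 2 → ℝ := fun e => g e / Real.sqrt 2 with ha
  rw [thermalCorr_localPair_rev_eq]
  have hterm : ∀ e ∈ S, ∀ e' ∈ S,
      ‖((a e : ℝ) : ℂ) * ((a e' : ℝ) : ℂ) *
        (hubbardTorusWith 2 L t U μ).thermalCorr β
          (bondPair (FermionTorus.ofTorusSite x)
            (FermionTorus.ofTorusSite (x + Torus.proj L e)))
          (bondPair (FermionTorus.ofTorusSite y)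
            (FermionTorus.ofTorusSite (y + Torus.proj L e')))ᴴ‖ ≤
        |a e| * |a e'| * (4 * Real.exp 2 * D) := by
    intro e he e' he'
    rw [norm_mul, norm_mul, Complex.norm_real, Complex.norm_real, Real.norm_eq_abs,
      Real.norm_eq_abs]
    refine mul_le_mul_of_nonneg_left ?_ (by positivity)
    exact norm_thermalCorr_bondPair_rev_torus_le t U μ hβ x _ y _
      (torusDist_add_proj_le_one x he) (torusDist_add_proj_le_one y he')
  calc ‖∑ e ∈ S, ∑ e' ∈ S, ((a e : ℝ) : ℂ) * ((a e' : ℝ) : ℂ) *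
        (hubbardTorusWith 2 L t U μ).thermalCorr β
          (bondPair (FermionTorus.ofTorusSite x)
            (FermionTorus.ofTorusSite (x + Torus.proj L e)))
          (bondPair (FermionTorus.ofTorusSite y)
            (FermionTorus.ofTorusSite (y + Torus.proj L e')))ᴴ‖
      ≤ ∑ e ∈ S, ∑ e' ∈ S, |a e| * |a e'| * (4 * Real.exp 2 * D) := by
        refine (norm_sum_le _ _).trans (Finset.sum_le_sum fun e he => ?_)
        exact (norm_sum_le _ _).trans (Finset.sum_le_sum fun e' he' => hterm e he e' he')
    _ = 4 * Real.exp 2 * (∑ e ∈ S, |a e|) ^ 2 * D := by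
        rw [sq, Finset.sum_mul_sum, Finset.mul_sum, Finset.sum_mul]
        refine Finset.sum_congr rfl fun e _ => ?_
        rw [Finset.mul_sum, Finset.sum_mul]
        refine Finset.sum_congr rfl fun e' _ => ?_
        ring
    _ = pairFieldDecayConst g * D := by rw [pairFieldDecayConst]

variable (L)

/-- `⟨Δ_g† Δ_g⟩_β = Σ_{x,y} ⟨(P_x)† P_y⟩_β` (linearity of the Gibbs state). [cite: Scalapino1995, §2] -/
theorem gibbsState_conjTranspose_pairField_mul (β : ℝ)
    (H : Matrix (Finset (Orb (FermionTorus 2 L))) (Finset (Orb (FermionTorus 2 L))) ℂ) :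
    gibbsState β H ((pairField g L)ᴴ * pairField g L) =
      ∑ x : TorusSite 2 L, ∑ y : TorusSite 2 L, H.thermalCorr β (localPair g L x)ᴴ (localPair g L y) := by
  rw [pairField, conjTranspose_sum, Finset.sum_mul, map_sum]
  refine Finset.sum_congr rfl fun x _ => ?_
  rw [Finset.mul_sum, map_sum]
  rfl

/-- `⟨Δ_g Δ_g†⟩_β = Σ_{x,y} ⟨P_x (P_y)†⟩_β` (linearity of the Gibbs state). [cite: Scalapino1995, §2] -/
theorem gibbsState_pairField_mul_conjTranspose (β : ℝ)
    (H : Matrix (Finset (Orb (FermionTorus 2 L))) (Finset (Orb (FermionTorus 2 L))) ℂ) :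
    gibbsState β H (pairField g L * (pairField g L)ᴴ) =
      ∑ x : TorusSite 2 L, ∑ y : TorusSite 2 L, H.thermalCorr β (localPair g L x) (localPair g L y)ᴴ := by
  rw [pairField, conjTranspose_sum, Finset.sum_mul, map_sum]
  refine Finset.sum_congr rfl fun x _ => ?_
  rw [Finset.mul_sum, map_sum]
  rfl

variable {L}

/-- `Re ⟨Δ_g† Δ_g⟩_{β,L} ≤ C_g Σ_{x,y} (dist(x,y)+1)^{-f(β|t|)}` (the sibling's two-point bound, summed).
[cite: KomaTasakiPRL1992, Theorem eq. (2) and footnote [10]] -/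
theorem re_gibbsState_conjTranspose_pairField_mul_le (t U μ : ℝ) {β : ℝ} (hβ : 0 ≤ β) :
    (gibbsState β (hubbardTorusWith 2 L t U μ) ((pairField g L)ᴴ * pairField g L)).re ≤
      pairFieldDecayConst g * ∑ x : TorusSite 2 L, ∑ y : TorusSite 2 L,
        ((torusDist x y : ℝ) + 1) ^ (-pairDecayExponent (β * |t|)) := by
  rw [gibbsState_conjTranspose_pairField_mul, Complex.re_sum, Finset.mul_sum]
  refine Finset.sum_le_sum fun x _ => ?_
  rw [Complex.re_sum, Finset.mul_sum]
  refine Finset.sum_le_sum fun y _ => ?_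
  exact (Complex.re_le_norm _).trans (norm_thermalCorr_localPair_le g t U μ hβ x y)

/-- `Re ⟨Δ_g Δ_g†⟩_{β,L} ≤ C_g Σ_{x,y} (dist(x,y)+1)^{-f(β|t|)}` (the reversed bound, summed).
[cite: KomaTasakiPRL1992, Theorem eq. (2) and footnote [10]] -/
theorem re_gibbsState_pairField_mul_conjTranspose_le (t U μ : ℝ) {β : ℝ} (hβ : 0 ≤ β) :
    (gibbsState β (hubbardTorusWith 2 L t U μ) (pairField g L * (pairField g L)ᴴ)).re ≤
      pairFieldDecayConst g * ∑ x : TorusSite 2 L, ∑ y : TorusSite 2 L,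
        ((torusDist x y : ℝ) + 1) ^ (-pairDecayExponent (β * |t|)) := by
  rw [gibbsState_pairField_mul_conjTranspose, Complex.re_sum, Finset.mul_sum]
  refine Finset.sum_le_sum fun x _ => ?_
  rw [Complex.re_sum, Finset.mul_sum]
  refine Finset.sum_le_sum fun y _ => ?_
  exact (Complex.re_le_norm _).trans (norm_thermalCorr_localPair_rev_le g t U μ hβ x y)

/-! ### The Duhamel (susceptibility) bound -/

/-- **The Duhamel pair-field function is dominated by the Koma–Tasaki majorant**: for every form factor `g`, all
`t, U, μ`, `β ≥ 0` and every side `L`,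
`Re (Δ_g†, Δ_g)_Duh ≤ C_g Σ_{x,y ∈ (ℤ/Lℤ)²} (dist(x,y)+1)^{-f(β|t|)}` — Dyson–Lieb–Simon's `b ≤ g`
(`Re (A, A†) ≤ ½(Re⟨AA†⟩ + Re⟨A†A⟩)`, tree `re_duhamel_conjTranspose_le`, at `A = Δ_g†`) and the two summed decay bounds.
[cite: DLS1978, Thm. 3.1] [cite: KomaTasakiPRL1992, Theorem eq. (2) and footnote [10]] -/
theorem re_duhamel_pairField_le (t U μ : ℝ) {β : ℝ} (hβ : 0 ≤ β) :
    (duhamel β (hubbardTorusWith 2 L t U μ) (pairField g L)ᴴ (pairField g L)).re ≤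
      pairFieldDecayConst g * ∑ x : TorusSite 2 L, ∑ y : TorusSite 2 L,
        ((torusDist x y : ℝ) + 1) ^ (-pairDecayExponent (β * |t|)) := by
  have hH : (hubbardTorusWith 2 L t U μ).IsHermitian := isHermitian_hamiltonianWith _ t U μ
  have h := re_duhamel_conjTranspose_le hH (pairField g L)ᴴ β
  rw [conjTranspose_conjTranspose] at h
  have h1 := re_gibbsState_conjTranspose_pairField_mul_le g t U μ hβ (L := L)
  have h2 := re_gibbsState_pairField_mul_conjTranspose_le g t U μ hβ (L := L)
  linarith

/-- **Cut-off form**: for every radius `R`, `Re (Δ_g†, Δ_g)_Duh ≤ C_g · L² · ((2R+1)² + L² (R+1)^{-f(β|t|)})`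
(row sums of the majorant, `sum_rpow_torusDist_le`) — the finite-volume content of "rule out the condensation of various
types of electron pairings" for the Duhamel carrier. [cite: KomaTasakiPRL1992, p. 3 and footnote [10]] [cite: DLS1978, Thm. 3.1] -/
theorem re_duhamel_pairField_le_of_radius (t U μ : ℝ) {β : ℝ} (hβ : 0 ≤ β) (R : ℕ) :
    (duhamel β (hubbardTorusWith 2 L t U μ) (pairField g L)ᴴ (pairField g L)).re ≤
      pairFieldDecayConst g * ((L : ℝ) ^ 2 *
        ((2 * R + 1 : ℝ) ^ 2 + (L : ℝ) ^ 2 * ((R : ℝ) + 1) ^ (-pairDecayExponent (β * |t|)))) := by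
  refine (re_duhamel_pairField_le g t U μ hβ).trans (mul_le_mul_of_nonneg_left ?_ (pairFieldDecayConst_nonneg g))
  have hf : 0 ≤ pairDecayExponent (β * |t|) := (pairDecayExponent_pos (by positivity)).le
  calc ∑ x : TorusSite 2 L, ∑ y : TorusSite 2 L,
        ((torusDist x y : ℝ) + 1) ^ (-pairDecayExponent (β * |t|))
      ≤ ∑ _x : TorusSite 2 L,
          ((2 * R + 1 : ℝ) ^ 2 + (L : ℝ) ^ 2 * ((R : ℝ) + 1) ^ (-pairDecayExponent (β * |t|))) :=
        Finset.sum_le_sum fun x _ => sum_rpow_torusDist_le L x hf R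
    _ = (L : ℝ) ^ 2 *
          ((2 * R + 1 : ℝ) ^ 2 + (L : ℝ) ^ 2 * ((R : ℝ) + 1) ^ (-pairDecayExponent (β * |t|))) := by
        rw [Finset.sum_const, nsmul_eq_mul, Finset.card_univ, Fintype.card_pi]
        simp [ZMod.card, Finset.prod_const]

/-- **No Duhamel pair-field order at positive temperature in two dimensions** (quantitative, uniform in `U`, `μ` and the
side): for every form factor `g`, hopping `t`, `β ≥ 0` and `ε > 0` there is `L₀` such that
`Re (Δ_g†, Δ_g)_Duh / L⁴ ≤ ε` for all `L ≥ L₀` and ALL `U`, `μ` — equivalently the static pair-field susceptibility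
`β Re (Δ_g†, Δ_g)_Duh / L²` is `o(L²)` at every fixed temperature (`R` with `C_g (R+1)^{-f} ≤ ε/2`, then `L₀` with
`C_g (2R+1)²/L₀² ≤ ε/2`). [cite: KomaTasakiPRL1992, p. 3 ("rule out the condensation of various types of electron pairings")]
[cite: DLS1978, Thm. 3.1] -/
theorem re_duhamel_pairField_div_small (t : ℝ) {β : ℝ} (hβ : 0 ≤ β) {ε : ℝ} (hε : 0 < ε) :
    ∃ L₀ : ℕ, ∀ (L : ℕ) [NeZero L], L₀ ≤ L → ∀ U μ : ℝ,
      (duhamel β (hubbardTorusWith 2 L t U μ) (pairField g L)ᴴ (pairField g L)).re / (L : ℝ) ^ 4 ≤ ε := by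
  set C : ℝ := pairFieldDecayConst g with hC
  have hC0 : 0 ≤ C := pairFieldDecayConst_nonneg g
  set f : ℝ := pairDecayExponent (β * |t|) with hf
  have hf0 : 0 < f := pairDecayExponent_pos (by positivity)
  -- the far field: `C (R+1)^{-f} ≤ ε/2`
  have h1 : Filter.Tendsto (fun R : ℕ => C * ((R : ℝ) + 1) ^ (-f)) Filter.atTop (nhds 0) := by
    have := ((tendsto_rpow_neg_atTop hf0).comp
      (Filter.tendsto_atTop_add_const_right Filter.atTop (1 : ℝ)
        tendsto_natCast_atTop_atTop)).const_mul C
    simpa using this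
  obtain ⟨R, hR⟩ := (h1.eventually (eventually_le_nhds (half_pos hε))).exists
  -- the near field: `C (2R+1)² / L² ≤ ε/2` for `L ≥ L₀`
  have h2 : Filter.Tendsto (fun L : ℕ => C * (2 * R + 1 : ℝ) ^ 2 / (L : ℝ) ^ 2) Filter.atTop (nhds 0) :=
    tendsto_const_nhds.div_atTop
      ((Filter.tendsto_pow_atTop two_ne_zero).comp tendsto_natCast_atTop_atTop)
  obtain ⟨L₀, hL₀⟩ := Filter.eventually_atTop.1 (h2.eventually (eventually_le_nhds (half_pos hε)))
  refine ⟨L₀, fun L _ hL U μ => ?_⟩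
  have hLpos : (0 : ℝ) < (L : ℝ) := by exact_mod_cast Nat.pos_of_ne_zero (NeZero.ne L)
  have hL2 : (0 : ℝ) < (L : ℝ) ^ 2 := by positivity
  have hL4 : (0 : ℝ) < (L : ℝ) ^ 4 := by positivity
  have hnear : C * (2 * R + 1 : ℝ) ^ 2 ≤ ε / 2 * (L : ℝ) ^ 2 := by
    have := hL₀ L hL
    rwa [div_le_iff₀ hL2] at this
  rw [div_le_iff₀ hL4]
  calc (duhamel β (hubbardTorusWith 2 L t U μ) (pairField g L)ᴴ (pairField g L)).re
      ≤ C * ((L : ℝ) ^ 2 * ((2 * R + 1 : ℝ) ^ 2 + (L : ℝ) ^ 2 * ((R : ℝ) + 1) ^ (-f))) :=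
        re_duhamel_pairField_le_of_radius g t U μ hβ R
    _ = (C * (2 * R + 1 : ℝ) ^ 2) * (L : ℝ) ^ 2 +
          (C * ((R : ℝ) + 1) ^ (-f)) * ((L : ℝ) ^ 2 * (L : ℝ) ^ 2) := by ring
    _ ≤ (ε / 2 * (L : ℝ) ^ 2) * (L : ℝ) ^ 2 + (ε / 2) * ((L : ℝ) ^ 2 * (L : ℝ) ^ 2) := by
        gcongr
    _ = ε * (L : ℝ) ^ 4 := by ring

end PairField

end Literature.Barriers.HubbardSuperconductivity
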